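import Mathlib.Analysis.Calculus.MeanValue
import Mathlib.Analysis.Normed.Affine.AddTorsor
import Mathlib.Analysis.Convex.Combination
import Mathlib.LinearAlgebra.AffineSpace.Basis
import Mathlib.LinearAlgebra.AffineSpace.FiniteDimensional
import Literature.Analysis.Convexity.Nondegenerate
import HarnessLib

/-!
# Secant maps of smooth maps on non-degenerate simplices (Munkres 9.1–9.3)

The *secant map* of a map `g` on a simplex `t` is the affine map agreeing with `g` at the
vertices of `t` (Munkres, *Elementary differential topology* (1966), 9.1).  We construct it in a
finite-dimensional real normed space (`exists_affineMap_eqOn`, by extending `t` to an affine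
basis and interpolating) and prove the two estimates of Munkres 9.3:

* `norm_secant_sub_le` — the `C⁰` estimate: `‖A x - G x‖ ≤ δ` on the simplex as soon as
  `‖G v - G x‖ ≤ δ` for the vertices `v`;
* `norm_secant_sub_sub_le` — the `C¹` estimate in two-point form: if `t` is `c`-non-degenerate
  (`Literature.Analysis.Convexity.Nondegenerate`) and `‖G v - G x - φ (v - x)‖ ≤ η ‖v - x‖` at the
  vertices (a Taylor estimate at `x`, `φ = G'(x)`), then
  `‖(A y - A x) - φ (y - x)‖ ≤ (#t η / c) ‖y - x‖` for `x, y` in the simplex — the diameter of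
  `t` cancels against the non-degeneracy, so the estimate is uniform over uniformly
  non-degenerate subdivisions (the role of thickness in Munkres 9.3);
* `norm_sub_sub_fderiv_le_of_lipschitzOnWith` — the Taylor estimate `η = L ‖v - x‖` from an
  `L`-Lipschitz derivative (mean value inequality).

No named facts are introduced.

## References

* J.R. Munkres, *Elementary differential topology*, Ann. of Math. Studies 54 (1963; rev. 1966),
  §9, 9.1–9.3. [Munkres1966]
-/

open Set Function
open scoped Topology NNReal

noncomputable section

namespace Literature.Analysis.Convexity

section SecantMap

variable {W : Type*} [NormedAddCommGroup W] [NormedSpace ℝ W] [FiniteDimensional ℝ W]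
  {V : Type*} [NormedAddCommGroup V] [NormedSpace ℝ V]

/-- **The secant map exists.** For an affinely independent finite configuration `t` in a
finite-dimensional space and any values `g`, there is an affine map agreeing with `g` on `t`
(extend `t` to an affine basis and interpolate). Munkres (1966), 9.1. [folklore] -/
theorem exists_affineMap_eqOn {t : Finset W} (ht : AffineIndependent ℝ ((↑) : t → W))
    (g : W → V) : ∃ A : W →ᵃ[ℝ] V, ∀ v ∈ t, A v = g v := by
  classical
  obtain ⟨T, htT, hTind, hTtot⟩ := exists_subset_affineIndependent_affineSpan_eq_top ht
  haveI : Finite T := (finite_set_of_fin_dim_affineIndependent ℝ hTind).to_subtype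
  haveI : Fintype T := Fintype.ofFinite T
  let β : AffineBasis ↥T ℝ W := ⟨(↑), hTind, by rw [Subtype.range_coe]; exact hTtot⟩
  refine ⟨(Finset.univ.affineCombination ℝ (fun i : ↥T => g i)).comp
    (β.coords : W →ᵃ[ℝ] (↥T → ℝ)), fun v hv => ?_⟩
  have hv' : v ∈ T := htT hv
  have hβ : β ⟨v, hv'⟩ = v := rfl
  rw [AffineMap.comp_apply, ← hβ]
  have hcoords : (β.coords : W →ᵃ[ℝ] (↥T → ℝ)) (β ⟨v, hv'⟩) = fun i => if i = ⟨v, hv'⟩ then 1 else 0 := by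
    ext i
    rw [AffineBasis.coords_apply, AffineBasis.coord_apply]
  rw [hcoords]
  exact Finset.univ.affineCombination_of_eq_one_of_eq_zero _ _ (Finset.mem_univ (⟨v, hv'⟩ : ↥T))
    (if_pos rfl) (fun i _ hi => if_neg hi)

end SecantMap

section Combination

variable {W : Type*} [NormedAddCommGroup W] [NormedSpace ℝ W]
  {V : Type*} [NormedAddCommGroup V] [NormedSpace ℝ V]

/-- An affine map agreeing with `g` on `t` sends convex (indeed affine) combinations of points
of `t` to the corresponding combinations of values. [folklore] -/
theorem affineMap_apply_sum_smul {t : Finset W} {g : W → V} {A : W →ᵃ[ℝ] V}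
    (hA : ∀ v ∈ t, A v = g v) {w : W → ℝ} (hw : ∑ v ∈ t, w v = 1) :
    A (∑ v ∈ t, w v • v) = ∑ v ∈ t, w v • g v := by
  have h1 : (∑ v ∈ t, w v • v) = t.affineCombination ℝ id w :=
    (Finset.affineCombination_eq_linear_combination t id w hw).symm
  rw [h1, Finset.map_affineCombination t id w hw A,
    Finset.affineCombination_eq_linear_combination _ _ _ hw]
  exact Finset.sum_congr rfl fun v hv => by simp [hA v hv]

/-- Difference of values of the secant map at two points of the simplex: a balanced combination
of the vertex values. [folklore] -/
theorem exists_weights_sub {t : Finset W} {g : W → V} {A : W →ᵃ[ℝ] V}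
    (hA : ∀ v ∈ t, A v = g v) {x y : W} (hx : x ∈ convexHull ℝ (t : Set W))
    (hy : y ∈ convexHull ℝ (t : Set W)) :
    ∃ c : W → ℝ, ∑ v ∈ t, c v = 0 ∧ ∑ v ∈ t, c v • v = y - x ∧
      A y - A x = ∑ v ∈ t, c v • g v ∧ ∀ v ∈ t, |c v| ≤ 1 := by
  obtain ⟨w, hw0, hw1, hwx⟩ := Finset.mem_convexHull'.1 hx
  obtain ⟨w', hw'0, hw'1, hw'y⟩ := Finset.mem_convexHull'.1 hy
  refine ⟨fun v => w' v - w v, ?_, ?_, ?_, fun v hv => ?_⟩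
  · simp only [Finset.sum_sub_distrib, hw1, hw'1, sub_self]
  · simp only [sub_smul, Finset.sum_sub_distrib, hwx, hw'y]
  · rw [← hwx, ← hw'y, affineMap_apply_sum_smul hA hw1, affineMap_apply_sum_smul hA hw'1]
    simp only [sub_smul, Finset.sum_sub_distrib]
  · have h1 : w v ≤ 1 := by
      rw [← hw1]; exact Finset.single_le_sum (fun u hu => hw0 u hu) hv
    have h2 : w' v ≤ 1 := by
      rw [← hw'1]; exact Finset.single_le_sum (fun u hu => hw'0 u hu) hv
    have h3 := hw0 v hv
    have h4 := hw'0 v hv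
    rw [abs_le]; constructor <;> linarith

end Combination

/-! ### The estimates of Munkres 9.3 -/

section Estimates

variable {W : Type*} [NormedAddCommGroup W] [NormedSpace ℝ W]
  {V : Type*} [NormedAddCommGroup V] [NormedSpace ℝ V]

/-- **`C⁰` estimate for the secant map.** If `A` agrees with `G` on the vertices of `t` and
`‖G v - G x‖ ≤ δ` for all vertices `v`, then `‖A x - G x‖ ≤ δ` for `x ∈ convexHull t`.
Munkres (1966), 9.3 (first half). [folklore] -/
theorem norm_secant_sub_le {t : Finset W} {G : W → V} {A : W →ᵃ[ℝ] V}
    (hA : ∀ v ∈ t, A v = G v) {x : W} (hx : x ∈ convexHull ℝ (t : Set W)) {δ : ℝ}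
    (hδ : ∀ v ∈ t, ‖G v - G x‖ ≤ δ) : ‖A x - G x‖ ≤ δ := by
  obtain ⟨w, hw0, hw1, hwx⟩ := Finset.mem_convexHull'.1 hx
  have hAx : A x = ∑ v ∈ t, w v • G v := by rw [← hwx, affineMap_apply_sum_smul hA hw1]
  have hGx : G x = ∑ v ∈ t, w v • G x := by
    rw [← Finset.sum_smul, hw1, one_smul]
  rw [hAx, hGx, ← Finset.sum_sub_distrib]
  calc ‖∑ v ∈ t, (w v • G v - w v • G x)‖ ≤ ∑ v ∈ t, ‖w v • G v - w v • G x‖ := norm_sum_le _ _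
    _ = ∑ v ∈ t, w v * ‖G v - G x‖ := Finset.sum_congr rfl fun v hv => by
        rw [← smul_sub, norm_smul, Real.norm_of_nonneg (hw0 v hv)]
    _ ≤ ∑ v ∈ t, w v * δ := Finset.sum_le_sum fun v hv =>
        mul_le_mul_of_nonneg_left (hδ v hv) (hw0 v hv)
    _ = δ := by rw [← Finset.sum_mul, hw1, one_mul]

/-- Distance from a point of the simplex to a vertex is at most the diameter of the vertex set.
[folklore] -/
theorem norm_sub_le_of_mem_convexHull {t : Finset W} {x : W} (hx : x ∈ convexHull ℝ (t : Set W))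
    {D : ℝ} (hD : ∀ u ∈ t, ∀ u' ∈ t, ‖u - u'‖ ≤ D) {v : W} (hv : v ∈ t) : ‖v - x‖ ≤ D := by
  obtain ⟨w, hw0, hw1, hwx⟩ := Finset.mem_convexHull'.1 hx
  have hvx : v - x = ∑ u ∈ t, w u • (v - u) := by
    rw [← hwx]
    simp only [smul_sub, Finset.sum_sub_distrib, ← Finset.sum_smul, hw1, one_smul]
  rw [hvx]
  calc ‖∑ u ∈ t, w u • (v - u)‖ ≤ ∑ u ∈ t, ‖w u • (v - u)‖ := norm_sum_le _ _
    _ = ∑ u ∈ t, w u * ‖v - u‖ := Finset.sum_congr rfl fun u hu => by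
        rw [norm_smul, Real.norm_of_nonneg (hw0 u hu)]
    _ ≤ ∑ u ∈ t, w u * D := Finset.sum_le_sum fun u hu =>
        mul_le_mul_of_nonneg_left (hD v hv u hu) (hw0 u hu)
    _ = D := by rw [← Finset.sum_mul, hw1, one_mul]

/-- **`C¹` estimate for the secant map, two-point form** (Munkres (1966), 9.3). Let `A` agree
with `G` on the vertices of the `c`-non-degenerate configuration `t` (`c > 0`), let
`x, y ∈ convexHull t`, and let the continuous linear map `φ` (think `φ = G'(x)`) satisfy the
Taylor estimate `‖G v - G x - φ (v - x)‖ ≤ η * ‖v - x‖` at the vertices. Then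
`‖(A y - A x) - φ (y - x)‖ ≤ (#t * η / c) * ‖y - x‖`: the secant map is `C¹`-close to `G`
as soon as `η` (of the order of `Lip(G') · diam t`) is small, *uniformly in the shape of `t`
given its non-degeneracy*. [cite: Munkres1966, Lemma 9.3] -/
theorem norm_secant_sub_sub_le {t : Finset W} {G : W → V} {A : W →ᵃ[ℝ] V}
    (hA : ∀ v ∈ t, A v = G v) {c : ℝ} (hc : 0 < c) (ht : Nondegenerate c t) {x y : W}
    (hx : x ∈ convexHull ℝ (t : Set W)) (hy : y ∈ convexHull ℝ (t : Set W)) (φ : W →L[ℝ] V)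
    {η : ℝ} (hη : 0 ≤ η) (hG : ∀ v ∈ t, ‖G v - G x - φ (v - x)‖ ≤ η * ‖v - x‖) :
    ‖(A y - A x) - φ (y - x)‖ ≤ (t.card * η / c) * ‖y - x‖ := by
  classical
  obtain ⟨cw, hc0, hcv, hcA, -⟩ := exists_weights_sub hA hx hy
  -- rewrite the difference as a balanced combination of Taylor remainders
  have key : (A y - A x) - φ (y - x) = ∑ v ∈ t, cw v • (G v - G x - φ (v - x)) := by
    have h1 : ∑ v ∈ t, cw v • (G v - G x - φ (v - x)) =
        ∑ v ∈ t, cw v • G v - ∑ v ∈ t, cw v • φ v := by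
      simp only [smul_sub, map_sub, Finset.sum_sub_distrib]
      rw [show (∑ v ∈ t, cw v • G x) = 0 by rw [← Finset.sum_smul, hc0, zero_smul],
        show (∑ v ∈ t, cw v • φ x) = 0 by rw [← Finset.sum_smul, hc0, zero_smul]]
      abel
    have h2 : φ (y - x) = ∑ v ∈ t, cw v • φ v := by
      rw [← hcv, map_sum]
      simp only [map_smul]
    rw [h1, hcA, h2]
  rcases t.eq_empty_or_nonempty with rfl | hne
  · simp at hx
  -- a pair of vertices realising the diameter
  obtain ⟨q, hq, hqmax⟩ := Finset.exists_max_image (t ×ˢ t) (fun q => ‖q.1 - q.2‖)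
    (hne.product hne)
  set D : ℝ := ‖q.1 - q.2‖ with hD
  have hDmax : ∀ u ∈ t, ∀ u' ∈ t, ‖u - u'‖ ≤ D := fun u hu u' hu' =>
    hqmax (u, u') (Finset.mem_product.2 ⟨hu, hu'⟩)
  have hq1 : q.1 ∈ t := (Finset.mem_product.1 hq).1
  have hq2 : q.2 ∈ t := (Finset.mem_product.1 hq).2
  rcases (norm_nonneg (q.1 - q.2) : 0 ≤ D).lt_or_eq with hDpos | hD0
  · -- weights are bounded by non-degeneracy: `c * |cw v| * D ≤ ‖y - x‖`
    have hwb : ∀ v ∈ t, |cw v| ≤ ‖y - x‖ / (c * D) := fun v hv => by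
      rw [le_div_iff₀ (mul_pos hc hDpos)]
      have := ht cw hc0 v hv q.1 hq1 q.2 hq2
      rw [hcv] at this
      linarith
    rw [key]
    calc ‖∑ v ∈ t, cw v • (G v - G x - φ (v - x))‖
        ≤ ∑ v ∈ t, ‖cw v • (G v - G x - φ (v - x))‖ := norm_sum_le _ _
      _ ≤ ∑ v ∈ t, ‖y - x‖ / (c * D) * (η * D) := Finset.sum_le_sum fun v hv => by
          rw [norm_smul, Real.norm_eq_abs]
          refine mul_le_mul (hwb v hv) ((hG v hv).trans ?_) (norm_nonneg _)
            (div_nonneg (norm_nonneg _) (mul_pos hc hDpos).le)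
          exact mul_le_mul_of_nonneg_left (norm_sub_le_of_mem_convexHull hx hDmax hv) hη
      _ = t.card * (‖y - x‖ / (c * D) * (η * D)) := by rw [Finset.sum_const, nsmul_eq_mul]
      _ = t.card * η / c * ‖y - x‖ := by
          have hD0 : D ≠ 0 := hDpos.ne'
          field_simp
  · -- degenerate diameter: all vertices coincide, so `x = y`
    have hall : ∀ u ∈ t, ∀ u' ∈ t, u = u' := fun u hu u' hu' => by
      have := hDmax u hu u' hu'
      rw [hD, ← hD0] at this
      exact sub_eq_zero.1 (norm_le_zero_iff.1 this)
    obtain ⟨v₀, hv₀⟩ := hne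
    have hx0 : x = v₀ := by
      have := norm_sub_le_of_mem_convexHull hx hDmax hv₀
      rw [hD, ← hD0] at this
      exact (sub_eq_zero.1 (norm_le_zero_iff.1 this)).symm
    have hy0 : y = v₀ := by
      have := norm_sub_le_of_mem_convexHull hy hDmax hv₀
      rw [hD, ← hD0] at this
      exact (sub_eq_zero.1 (norm_le_zero_iff.1 this)).symm
    rw [hx0, hy0, sub_self, sub_self, map_zero, sub_zero, norm_zero, norm_zero, mul_zero]

/-- **The Taylor estimate from a Lipschitz derivative.** If `G` is differentiable on a convex set
`s` with `HasFDerivWithinAt G (G' z) s z` and `z ↦ G' z` is `L`-Lipschitz on `s`, then for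
`x, v ∈ s`: `‖G v - G x - G' x (v - x)‖ ≤ (L * ‖v - x‖) * ‖v - x‖`. (Mean value inequality
applied to `G - G' x`.) [folklore] -/
theorem norm_sub_sub_fderiv_le_of_lipschitzOnWith {G : W → V} {G' : W → W →L[ℝ] V} {s : Set W}
    (hs : Convex ℝ s) (hG : ∀ z ∈ s, HasFDerivWithinAt G (G' z) s z) {L : ℝ≥0}
    (hL : LipschitzOnWith L G' s) {x v : W} (hx : x ∈ s) (hv : v ∈ s) :
    ‖G v - G x - G' x (v - x)‖ ≤ (L * ‖v - x‖) * ‖v - x‖ := by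
  -- apply the mean value inequality to `H z = G z - G' x z` on the segment `[x, v] ⊆ s`
  have hsub : segment ℝ x v ⊆ s := hs.segment_subset hx hv
  have hseg : ∀ z ∈ segment ℝ x v, ‖z - x‖ ≤ ‖v - x‖ := fun z hz => by
    rw [segment_eq_image_lineMap] at hz
    obtain ⟨θ, hθ, rfl⟩ := hz
    rw [← dist_eq_norm, dist_lineMap_left, ← dist_eq_norm, dist_comm x v, Real.norm_of_nonneg hθ.1]
    exact mul_le_of_le_one_left dist_nonneg hθ.2
  have hH : ∀ z ∈ segment ℝ x v, HasFDerivWithinAt (fun z => G z - G' x z) (G' z - G' x)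
      (segment ℝ x v) z := fun z hz =>
    ((hG z (hsub hz)).mono hsub).sub ((G' x).hasFDerivWithinAt)
  have hbound : ∀ z ∈ segment ℝ x v, ‖G' z - G' x‖ ≤ L * ‖v - x‖ := fun z hz => by
    calc ‖G' z - G' x‖ = dist (G' z) (G' x) := (dist_eq_norm _ _).symm
      _ ≤ L * dist z x := hL.dist_le_mul z (hsub hz) x hx
      _ = L * ‖z - x‖ := by rw [dist_eq_norm]
      _ ≤ L * ‖v - x‖ := mul_le_mul_of_nonneg_left (hseg z hz) L.2
  have := (convex_segment x v).norm_image_sub_le_of_norm_hasFDerivWithin_le hH hbound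
    (left_mem_segment ℝ x v) (right_mem_segment ℝ x v)
  calc ‖G v - G x - G' x (v - x)‖ = ‖G v - G' x v - (G x - G' x x)‖ := by
        rw [map_sub]; congr 1; abel
    _ ≤ (L * ‖v - x‖) * ‖v - x‖ := this

end Estimates

end Literature.Analysis.Convexity
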